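import Mathlib
import Literature.Computability.AlgebraicComplexity.NewtonPolygonTauProductBounds
import Summits.ValiantsHypothesis.ValiantsHypothesis.Theorems.NewtonUnitEquationsDissociatedUniformTotalsLaw
import Summits.ValiantsHypothesis.ValiantsHypothesis.Theorems.NewtonUnitEquationsDissociatedUniformTotalsLawPartnerSets
import HarnessLib

/-!
# Crux `NewtonUnitEquations.DissociatedUniform` (stmt-ValiantsHypothesis-5905): the `n = 3` totals law — the DEGREE–GAP INEQUALITY
# (a letter with many fibre-top partners is value-shallow: `deg · gap ≤ |G| · osc / 2`)

Memo `Cruxes/DissociatedUniform/NOTES-t1g17.md` §3; companion of `…TotalsLawPartnerSets` (structured partner sets) and of the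
degree bookkeeping of `…TotalsLawHeavyPairs` / `…TotalsLawTriangleWords` (`topDeg`).  At a weight write `α = ⟨w, a ·⟩`, `γ = ⟨w, c ·⟩`;
the `R`-partner set of the letter `x` is `N_R(x) = {z : a x + c z is the strict top of its fibre R_{x+z}}`, `deg_R x = #N_R(x)`.  Comparing
each partner pair `(x, z)` with the competitor `(x', z − (x' − x))` built on ANOTHER letter `x'` and summing over `z ∈ N`
(`…PartnerSets.card_mul_sub_le_of_partners`) gives `#N · (α x' − α x) ≤ Σ_{z∈N} (γ z − γ(z − d))`, `d = x' − x`; and the right side is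
at most the POSITIVE VARIATION of the `d`-increments of `γ`, which is half their absolute variation because the increments sum to zero
over the group: `Σ_{z∈N} (γ z − γ(z−d)) ≤ ½ Σ_z |γ z − γ(z−d)| ≤ |G|·(M − m)/2` for `m ≤ γ ≤ M` (`sum_sub_shift_le_half_card_mul`).  Hence
* **`card_mul_gap_le`**: `#N · (α x' − α x) ≤ |G| (M − m) / 2` — with `x'` the top letter of `A`: a letter of `R`-degree `n` lies within
  `|G|·osc(γ)/(2n)` of the top VALUE of `A` at that weight ("heavy letters are value-shallow"; the rank can still be large — coset
  example in the memo — which is where `…PartnerSets` takes over);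
* **`card_mul_gap_le_of_tops`**: the same read off strict fibre tops (`KPTT.PlanarMinkowski`-style dot products);
* **`card_mul_depth_le_of_tops`**: for a pair `(x, y)` with `n ≤ deg_R x` and `n ≤ deg_Q y` (a HEAVY PAIR of `…HeavyPairs`), the point
  `a x + b y` lies within `|G|·osc(γ)/n` of `⟨w, a x'⟩ + ⟨w, b y'⟩` for ANY letters `x', y'` — i.e. within `|G|·w_C/n` of the support
  value of `A + B`: heavy pairs are depth-shallow points of the pair sumset, at the scale `(|G|/n)·w_C(w)` set by the THIRD curve.
Honest label: elementary averaging inequalities (no new bound on `T`); they quantify the "random-like" side of the coupling that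
exponent `2` needs (memo §3), complementing the structured side of `…PartnerSets`; `TotalsLawThree C`, `TriWordsBound C` remain OPEN and
are asserted nowhere; nothing here bears on VP ≠ VNP.
[folklore]
-/

set_option linter.dupNamespace false -- `ValiantsHypothesis.ValiantsHypothesis` (summit = problem) in every name

open Matrix Finset
open scoped BigOperators Pointwise

namespace Summit.ValiantsHypothesis.ValiantsHypothesis.Theorems.NewtonUnitEquationsDissociatedUniform

namespace TotalsLaw

open Literature.Computability.AlgebraicComplexity.KPTT.PlanarMinkowski

variable {G : Type*} [AddCommGroup G] [Fintype G]

/-- The `d`-increments of a function on a finite group sum to zero. [folklore] -/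
theorem sum_sub_shift_eq_zero (γ : G → ℝ) (d : G) : ∑ z, (γ z - γ (z - d)) = 0 := by
  rw [Finset.sum_sub_distrib, sub_eq_zero]
  exact (Equiv.sum_comp (Equiv.subRight d) γ).symm

/-- **Positive variation is half the absolute variation**: over any sub-family `N`,
`Σ_{z∈N} (γ z − γ(z−d)) ≤ ½ Σ_z |γ z − γ(z−d)|` (the increments over the whole group cancel). [folklore] -/
theorem sum_sub_shift_le_half_abs (γ : G → ℝ) (d : G) (N : Finset G) :
    ∑ z ∈ N, (γ z - γ (z - d)) ≤ (∑ z, |γ z - γ (z - d)|) / 2 := by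
  classical
  set f : G → ℝ := fun z => γ z - γ (z - d) with hf
  -- `Σ_N f ≤ Σ_univ f⁺`
  have h1 : ∑ z ∈ N, f z ≤ ∑ z, max (f z) 0 :=
    (Finset.sum_le_sum fun z _ => le_max_left (f z) 0).trans
      (Finset.sum_le_sum_of_subset_of_nonneg (Finset.subset_univ N) fun z _ _ => le_max_right _ _)
  -- `2 f⁺ = |f| + f`, and `Σ f = 0`
  have h2 : ∑ z, max (f z) 0 = (∑ z, |f z|) / 2 := by
    have key : ∀ z, 2 * max (f z) 0 = |f z| + f z := by
      intro z
      rcases le_or_gt 0 (f z) with h | h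
      · rw [max_eq_left h, abs_of_nonneg h]; ring
      · rw [max_eq_right h.le, abs_of_neg h]; ring
    have hs : 2 * ∑ z, max (f z) 0 = ∑ z, |f z| + ∑ z, f z := by
      rw [Finset.mul_sum, ← Finset.sum_add_distrib]
      exact Finset.sum_congr rfl fun z _ => key z
    rw [sum_sub_shift_eq_zero γ d, add_zero] at hs
    linarith
  simpa [hf] using h1.trans h2.le

/-- **Bounded increments**: if `m ≤ γ ≤ M` then `Σ_{z∈N} (γ z − γ(z−d)) ≤ |G|·(M − m)/2`. [folklore] -/
theorem sum_sub_shift_le_half_card_mul (γ : G → ℝ) (d : G) (N : Finset G) (m M : ℝ) (hγ : ∀ z, m ≤ γ z ∧ γ z ≤ M) :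
    ∑ z ∈ N, (γ z - γ (z - d)) ≤ Fintype.card G * (M - m) / 2 := by
  refine (sum_sub_shift_le_half_abs γ d N).trans ?_
  have h : ∑ z, |γ z - γ (z - d)| ≤ ∑ _z : G, (M - m) :=
    Finset.sum_le_sum fun z _ => abs_sub_le_iff.2 ⟨by linarith [(hγ z).2, (hγ (z - d)).1], by linarith [(hγ z).1, (hγ (z - d)).2]⟩
  rw [Finset.sum_const, Finset.card_univ, nsmul_eq_mul] at h
  linarith

/-- **Degree–gap inequality (abstract form).**  If every partner `z ∈ N` of the letter `x` (weakly) beats the competitor built on the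
letter `x'`, i.e. `α x' + γ(z − (x' − x)) ≤ α x + γ z`, and `m ≤ γ ≤ M`, then `#N · (α x' − α x) ≤ |G|·(M − m)/2`: a letter with `n`
partners lies within `|G|(M−m)/(2n)` of the value of ANY other letter, in particular of the top of `A`. [folklore] -/
theorem card_mul_gap_le (α γ : G → ℝ) (x x' : G) (N : Finset G) (m M : ℝ) (hγ : ∀ z, m ≤ γ z ∧ γ z ≤ M)
    (h : ∀ z ∈ N, α x' + γ (z - (x' - x)) ≤ α x + γ z) :
    (N.card : ℝ) * (α x' - α x) ≤ Fintype.card G * (M - m) / 2 := by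
  have h1 := card_mul_sub_le_of_partners α γ x (x' - x) N (by simpa using h)
  simp only [add_sub_cancel] at h1
  have h2 := sum_sub_shift_le_half_card_mul γ (x' - x) N m M hγ
  have h3 : ∑ z ∈ N, γ z - ∑ z ∈ N, γ (z - (x' - x)) = ∑ z ∈ N, (γ z - γ (z - (x' - x))) := by
    rw [Finset.sum_sub_distrib]
  linarith

/-! ### Geometric reading: strict fibre tops -/

/-- **Degree–gap inequality for fibre tops.**  At a weight `w`, let `N` be a set of letters `z` such that `a x + c z` is the strict top
of its fibre `R_{x+z} = {a x'' + c z'' : x'' + z'' = x + z}`.  If `m ≤ ⟨w, c z⟩ ≤ M` for all `z`, then for every letter `x'`: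
`#N · (⟨w, a x'⟩ − ⟨w, a x⟩) ≤ |G|·(M − m)/2`. [folklore] -/
theorem card_mul_gap_le_of_tops (a c : G → (Fin 2 → ℝ)) (w : Fin 2 → ℝ) (x x' : G) (N : Finset G) (m M : ℝ)
    (hγ : ∀ z, m ≤ w ⬝ᵥ c z ∧ w ⬝ᵥ c z ≤ M)
    (htop : ∀ z ∈ N, ∀ x'' z'', x'' + z'' = x + z → (x'', z'') ≠ (x, z) → w ⬝ᵥ (a x'' + c z'') < w ⬝ᵥ (a x + c z)) :
    (N.card : ℝ) * (w ⬝ᵥ a x' - w ⬝ᵥ a x) ≤ Fintype.card G * (M - m) / 2 := by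
  refine card_mul_gap_le (fun u => w ⬝ᵥ a u) (fun z => w ⬝ᵥ c z) x x' N m M hγ fun z hz => ?_
  by_cases hx : x' = x
  · subst hx; simp
  · have hsum : x' + (z - (x' - x)) = x + z := by abel
    have hne : (x', z - (x' - x)) ≠ (x, z) := fun h => hx (Prod.mk.inj h).1
    have := htop z hz x' (z - (x' - x)) hsum hne
    simp only [dotProduct_add] at this
    exact this.le

/-- **Heavy pairs are depth-shallow.**  If at the weight `w` the letter `x` has `≥ n` strict `R`-partners (`NR`) and the letter `y`
has `≥ n` strict `Q`-partners (`NQ`), `n ≥ 1`, and `m ≤ ⟨w, c ·⟩ ≤ M`, then for all letters `x', y'`: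
`n · (⟨w, a x' + b y'⟩ − ⟨w, a x + b y⟩) ≤ |G|·(M − m)` — the point `a x + b y` is within `|G|·osc/n` of the support value of
`A + B` in direction `w` (take `x', y'` the top letters). [folklore] -/
theorem card_mul_depth_le_of_tops (a b c : G → (Fin 2 → ℝ)) (w : Fin 2 → ℝ) (x y x' y' : G) (NR NQ : Finset G) (n : ℕ)
    (m M : ℝ) (hγ : ∀ z, m ≤ w ⬝ᵥ c z ∧ w ⬝ᵥ c z ≤ M) (hn : 1 ≤ n) (hNR : n ≤ NR.card) (hNQ : n ≤ NQ.card)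
    (hR : ∀ z ∈ NR, ∀ x'' z'', x'' + z'' = x + z → (x'', z'') ≠ (x, z) → w ⬝ᵥ (a x'' + c z'') < w ⬝ᵥ (a x + c z))
    (hQ : ∀ z ∈ NQ, ∀ y'' z'', y'' + z'' = y + z → (y'', z'') ≠ (y, z) → w ⬝ᵥ (b y'' + c z'') < w ⬝ᵥ (b y + c z)) :
    (n : ℝ) * (w ⬝ᵥ (a x' + b y') - w ⬝ᵥ (a x + b y)) ≤ Fintype.card G * (M - m) := by
  have hm : m ≤ M := (hγ 0).1.trans (hγ 0).2
  have hq : (0 : ℝ) ≤ Fintype.card G * (M - m) / 2 := by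
    have : (0 : ℝ) ≤ Fintype.card G := by positivity
    have : (0 : ℝ) ≤ M - m := by linarith
    positivity
  have h1 := card_mul_gap_le_of_tops a c w x x' NR m M hγ hR
  have h2 := card_mul_gap_le_of_tops b c w y y' NQ m M hγ hQ
  have hn' : (1 : ℝ) ≤ n := by exact_mod_cast hn
  have hnR : (n : ℝ) ≤ NR.card := by exact_mod_cast hNR
  have hnQ : (n : ℝ) ≤ NQ.card := by exact_mod_cast hNQ
  -- pass from `#N` to `n` (the gaps may be negative, in which case the bound is trivial)
  have k1 : (n : ℝ) * (w ⬝ᵥ a x' - w ⬝ᵥ a x) ≤ Fintype.card G * (M - m) / 2 := by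
    rcases le_or_gt 0 (w ⬝ᵥ a x' - w ⬝ᵥ a x) with hpos | hneg
    · exact (mul_le_mul_of_nonneg_right hnR hpos).trans h1
    · exact (mul_nonpos_iff.2 (Or.inl ⟨by positivity, hneg.le⟩)).trans hq
  have k2 : (n : ℝ) * (w ⬝ᵥ b y' - w ⬝ᵥ b y) ≤ Fintype.card G * (M - m) / 2 := by
    rcases le_or_gt 0 (w ⬝ᵥ b y' - w ⬝ᵥ b y) with hpos | hneg
    · exact (mul_le_mul_of_nonneg_right hnQ hpos).trans h2
    · exact (mul_nonpos_iff.2 (Or.inl ⟨by positivity, hneg.le⟩)).trans hq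
  simp only [dotProduct_add]
  nlinarith

end TotalsLaw

end Summit.ValiantsHypothesis.ValiantsHypothesis.Theorems.NewtonUnitEquationsDissociatedUniform
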